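import Literature.NumberTheory.Rogawski1990.ArchSingularWitnessFamily              -- ★ (W4c): `conj_archDiagTorus_ne_archCongr_of_coe_eq_smul_one` and the (m2)∕stable-class-torus imports behind it
import Literature.NumberTheory.Automorphic.WeilFamilyOfCoherentTorusDatumPullback  -- ★ (W4b′): `exists_isQuotientOf_of_coherent_torusDatum_pullback`
import HarnessLib

/-!
# THE ARCHIMEDEAN SINGULAR WITNESS FAMILY on `U(H₂)(L ⊗ ℝ)` read on the diagonal carrier — WITH ITS DATUM EXPORTED AS THE PULL-BACK, and the guard read as a
# RATIONAL-TYPE wall datum («(W4c′)»; Rogawski 1990 §1.7, §3.8 Prop. 3.8.1 (a), §4.3 (4.3.1), Prop. 10.1.2 (b), §14.2, Lemma 14.5.2 (b))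

Topic `NumberTheory/Rogawski1990`; namespace `Literature.NumberTheory.Rogawski1990`.  THEOREMS ONLY (no `def`, no instance, no notation, no axiom, no named fact, no `sorry`).
Cell `pub/hodgecm-mathlib`, ENGINE T1 (crux H413 = `stmt-HodgeConjecture-24833`); the (ST-∞) witness road, brick (W4c′) (F0P3-p03 (g11); SPEC (W4f) of F0P3a-p07 (g9) route
(4a); LEAD F0P3a-plan (g10) WORD T9-22 (3)): the SUPERSEDE-NOT-EDIT twin of ★ (W4c) `exists_archSingularFamily_of_coherent_torusDatum` over ★ (W4b′), exporting in addition
(PULL) «at every `x` whose image `Φ_A x` lies in the wall saturation `Pall`, the datum `Ts x` IS the pull-back `(Φ_A⁻¹|_{Z(Φ_A x)})_* T (Φ_A x)`», and the guard lemma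
**`exists_conj_archDiagTorus_eq_archCongr_of_not_central`**: a point `x ∈ U(H₂)(L ⊗ ℝ)` corresponding to a NON-REGULAR rational `γ₀ ∈ U(H′)(L⁺)` and NOT a rational scalar
`ζ ⊗ 1` is `Φ_A`-conjugate IN `U(diag β)(L ⊗ ℝ)` to a wall torus point `q·t(zw∘ρ)·q⁻¹` whose wall datum is of RATIONAL TYPE `zw_w = (σ_w a, σ_w b, σ_w a)`, `a ≠ b ∈ L` the
eigenvalues of `γ₀` (★ (m2) + ★ stable class of a torus point = its relabelled classes) — the only wall classes the S1′ guard meets, and exactly the ones the universal pin ratio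
(U) (★ F0P3-p03 (g10) `smul_centralizerTopFormHaar_of_universal_pinRatio`, binder `_hrat`) speaks about.  Count-neutral; HONEST LABEL: HC_CM is proved only modulo the printed
citations until rung 0 closes; pays nothing by itself ((W4f) reads it).

## References
* [Rogawski1990] J. D. Rogawski, *Automorphic Representations of Unitary Groups in Three Variables*, Ann. of Math. Stud. 123 (1990), §1.7 p. 6; §3.8 Prop. 3.8.1 (a) p. 27; §4.3 (4.3.1)
  p. 43; Prop. 10.1.2 (b) p. 146; §14.2 (14.2.1) p. 232; §14.5 Lemma 14.5.2 (b) pp. 238–239.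
* [DeitmarEchterhoff2014] A. Deitmar, S. Echterhoff, *Principles of Harmonic Analysis*, 2nd ed. (2014), Thm. 1.5.3.
* [BorelJacquet1979] A. Borel, H. Jacquet, *Automorphic forms and automorphic representations*, PSPM 33.1 (1979), §4.1.
-/

set_option autoImplicit false

noncomputable section

open MeasureTheory Measure Set NumberField NumberField.InfinitePlace NumberField.mixedEmbedding Equiv
open Literature.MeasureTheory.Group Literature.NumberTheory.Automorphic
open Literature.NumberTheory.Automorphic.UnitaryGroup hiding hermForm
open Literature.AlgebraicGeometry.ShimuraVarieties (unitaryGroup hermForm)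
open scoped Matrix MatrixGroups

namespace Literature.NumberTheory.Rogawski1990

section ArchWitnessPullback

variable (L : Type) [Field L] [NumberField L] [IsCMField L] (H' : Matrix (Fin 3) (Fin 3) L) {H₂ : Matrix (Fin 3) (Fin 3) L} (β : Fin 3 → L)
  (T_A : GL (Fin 3) (mixedSpace L))
  (Φ_A : arch (↥(maximalRealSubfield L)) L (IsCMField.complexConj L) 3 H₂ ≃ₜ* arch (↥(maximalRealSubfield L)) L (IsCMField.complexConj L) 3 (Matrix.diagonal β))
  (hΦ_A : ∀ g : arch (↥(maximalRealSubfield L)) L (IsCMField.complexConj L) 3 H₂,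
    ((Φ_A g : arch (↥(maximalRealSubfield L)) L (IsCMField.complexConj L) 3 (Matrix.diagonal β)) : GL (Fin 3) (mixedSpace L)) = T_A * (g : GL (Fin 3) (mixedSpace L)) * T_A⁻¹)

include hΦ_A in
/-- **THE S1′ GUARD OFF THE CENTRE IS A RATIONAL-TYPE WALL CLASS ON THE DIAGONAL CARRIER.**  `H′` hermitian anisotropic, `β` real non-zero, `Φ_A : U(H₂)(L ⊗ ℝ) ≃ₜ* U(diag β)(L ⊗ ℝ)`
the congruence `g ↦ T_A g T_A⁻¹`.  If `x ∈ U(H₂)(L ⊗ ℝ)` corresponds to a NON-REGULAR rational `γ₀ ∈ U(H′)(L⁺)` (`γ₀ ⊗ 1 ↔ x`) and `x` is NOT a rational scalar `ζ ⊗ 1`, then there are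
`a ≠ b ∈ L` of norm one (the eigenvalues of `γ₀`: `γ₀` is semisimple (★ anisotropic), singular hence split `(γ₀ − a)(γ₀ − b) = 0` (★ Prop. 3.8.1 (a)), non-central since its correspondent
`x` is not a scalar), the wall datum `zw_w := (σ_w a, σ_w b, σ_w a)` (★ `archDiagTorus_wall_coords`), a relabelling `ρ` and `q ∈ U(diag β)(L ⊗ ℝ)` with `q · t(zw∘ρ) · q⁻¹ = Φ_A x`
(★ (m2) `isConj_coe_cmRationalToArch_coe_archDiagTorus` + ★ `exists_isConj_archDiagTorus_of_isStablyConj_of_conj`) — in particular `zw` is of RATIONAL TYPE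
`∃ a b, ∀ w, zw_w 0 = σ_w a ∧ zw_w 1 = σ_w b` (the `_hrat` binder of ★ (U)). [cite: Rogawski1990, §3.8 Prop. 3.8.1 (a) p. 27; §14.2 p. 232; §14.5 Lemma 14.5.2 (b) pp. 238–239] -/
theorem exists_conj_archDiagTorus_eq_archCongr_of_not_central (hherm : (H'.map (cmConjRingHom L))ᵀ = H')
    (hanis : ∀ x : Fin 3 → L, hermForm (cmConjRingHom L) H' x x = 0 → x = 0) (hβ : ∀ i, β i ≠ 0) (hhermβ : ∀ i, (IsCMField.complexConj L (β i) : L) = β i)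
    {x : arch (↥(maximalRealSubfield L)) L (IsCMField.complexConj L) 3 H₂}
    (hx : ∃ γ₀ : (cmDatum L 3 H').Rational, ¬ IsRegularElt (γ₀.val : GL (Fin 3) L) ∧
      Corresponds (conjMixed (↥(maximalRealSubfield L)) L (IsCMField.complexConj L)) (archFormOf L 3 H') (archFormOf L 3 H₂) (cmRationalToArch L 3 H' γ₀) x)
    (hnc : ¬ ∃ ζ : L, ((x : GL (Fin 3) (mixedSpace L)) : Matrix (Fin 3) (Fin 3) (mixedSpace L)) = mixedEmbedding L ζ • (1 : Matrix (Fin 3) (Fin 3) (mixedSpace L))) :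
    ∃ (zw : {w : InfinitePlace L // IsComplex w} → Fin 3 → Circle) (_ : ∀ w, zw w 0 = zw w 2 ∧ zw w 0 ≠ zw w 1)
      (_ : ∃ a b : L, ∀ w : {w : InfinitePlace L // IsComplex w}, ((zw w 0 : ℂ) = w.1.embedding a) ∧ ((zw w 1 : ℂ) = w.1.embedding b))
      (ρ : {w : InfinitePlace L // IsComplex w} → Perm (Fin 3)) (q : arch (↥(maximalRealSubfield L)) L (IsCMField.complexConj L) 3 (Matrix.diagonal β)),
      (MulAut.conj q : arch (↥(maximalRealSubfield L)) L (IsCMField.complexConj L) 3 (Matrix.diagonal β) ≃* arch (↥(maximalRealSubfield L)) L (IsCMField.complexConj L) 3 (Matrix.diagonal β))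
        (archDiagTorus L 3 β fun w => zw w ∘ ⇑(ρ w)) = Φ_A x := by
  have hdet : H'.det ≠ 0 := Godement.det_ne_zero_of_anisotropic L H' hanis
  obtain ⟨γ₀, hnreg, hcorr⟩ := hx
  have hss : IsSemisimpleElt (cmConjRingHom L) H' (γ₀ : unitaryGroup (cmConjRingHom L) H') := isSemisimpleElt_of_anisotropic (cmConjRingHom L) H' hanis _
  obtain ⟨e₁, e₂, he, h₁, h₂, hsplit⟩ := exists_ne_mul_sub_eq_zero_of_isSemisimpleElt_of_not_isRegularElt_cm L hherm hdet _ hss hnreg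
  -- `γ₀` is not central: its correspondent `x` would be the scalar `ζ ⊗ 1`
  have hc : ¬ ∃ ζ : L, (((γ₀ : unitaryGroup (cmConjRingHom L) H').val : GL (Fin 3) L) : Matrix (Fin 3) (Fin 3) L) = ζ • (1 : Matrix (Fin 3) (Fin 3) L) := by
    rintro ⟨ζ, hζ⟩
    refine hnc ⟨ζ, ?_⟩
    have h0 := coe_coe_cmRationalToArch_eq_smul_one_of_smul_one (L := L) (H := H') hζ
    obtain ⟨g, hg⟩ := isConj_iff.1 hcorr
    rw [← hg, commute_of_coe_eq_smul_one h0 g, mul_inv_cancel_right, h0]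
  -- split non-central: `Φ_A x ∼_st t(zw)`, and the stable class of `t(zw)` is the union of the classes of the `t(zw∘ρ)` (★ (W4c)'s proof, verbatim)
  obtain ⟨a, b, Q, hab, ha, hb, hγ, -⟩ := exists_eq_conj_diagonal_of_split L H' hherm hanis (γ₀ : unitaryGroup (cmConjRingHom L) H') he hsplit
    (fun h => hc ⟨e₁, h⟩) (fun h => hc ⟨e₂, h⟩)
  have hab' : a ≠ b := by
    rcases hab with ⟨rfl, rfl⟩ | ⟨rfl, rfl⟩
    · exact he
    · exact he.symm
  have ha' : (IsCMField.complexConj L a : L) * a = 1 := ha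
  have hb' : (IsCMField.complexConj L b : L) * b = 1 := hb
  obtain ⟨zw, hzw⟩ : ∃ zw : {w : InfinitePlace L // IsComplex w} → Fin 3 → Circle, zw = fun w =>
    ![(⟨w.1.embedding a, mem_sphere_zero_iff_norm.mpr (norm_embedding_eq_one_of_complexConj_mul_self L a ha' w)⟩ : Circle),
      ⟨w.1.embedding b, mem_sphere_zero_iff_norm.mpr (norm_embedding_eq_one_of_complexConj_mul_self L b hb' w)⟩,
      ⟨w.1.embedding a, mem_sphere_zero_iff_norm.mpr (norm_embedding_eq_one_of_complexConj_mul_self L a ha' w)⟩] := ⟨_, rfl⟩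
  have hwall : ∀ w, zw w 0 = zw w 2 ∧ zw w 0 ≠ zw w 1 := by
    intro w; subst hzw; exact archDiagTorus_wall_coords L hab' ha' hb' w
  have hrat : ∃ a b : L, ∀ w : {w : InfinitePlace L // IsComplex w}, ((zw w 0 : ℂ) = w.1.embedding a) ∧ ((zw w 1 : ℂ) = w.1.embedding b) :=
    ⟨a, b, fun w => by subst hzw; exact ⟨rfl, rfl⟩⟩
  have ht : IsConj ((cmRationalToArch L 3 H' γ₀ : arch (↥(maximalRealSubfield L)) L (IsCMField.complexConj L) 3 H') : GL (Fin 3) (mixedSpace L))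
      ((archDiagTorus L 3 β zw : arch (↥(maximalRealSubfield L)) L (IsCMField.complexConj L) 3 (Matrix.diagonal β)) : GL (Fin 3) (mixedSpace L)) :=
    isConj_coe_cmRationalToArch_coe_archDiagTorus L H' β γ₀ Q hγ zw fun w i => by subst hzw; fin_cases i <;> rfl
  have hst := isStablyConj_archCongr_of_isConj_coe L H₂ β T_A Φ_A hΦ_A (hcorr.symm.trans ht)
  obtain ⟨ρ, hρ⟩ := exists_isConj_archDiagTorus_of_isStablyConj_of_conj L 3 β hβ hhermβ zw (Φ_A x) hst.symm
  obtain ⟨q, hq⟩ := isConj_iff.1 hρ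
  exact ⟨zw, hwall, hrat, ρ, q, by rw [MulAut.conj_apply]; exact hq⟩

variable
  [MeasurableSpace (arch (↥(maximalRealSubfield L)) L (IsCMField.complexConj L) 3 H₂)] [BorelSpace (arch (↥(maximalRealSubfield L)) L (IsCMField.complexConj L) 3 H₂)]
  [MeasurableSpace (arch (↥(maximalRealSubfield L)) L (IsCMField.complexConj L) 3 (Matrix.diagonal β))]
  [BorelSpace (arch (↥(maximalRealSubfield L)) L (IsCMField.complexConj L) 3 (Matrix.diagonal β))]
  [∀ γ : arch (↥(maximalRealSubfield L)) L (IsCMField.complexConj L) 3 H₂,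
    MeasurableSpace (arch (↥(maximalRealSubfield L)) L (IsCMField.complexConj L) 3 H₂ ⧸ Subgroup.centralizer ({γ} : Set _))]
  [∀ γ : arch (↥(maximalRealSubfield L)) L (IsCMField.complexConj L) 3 H₂,
    BorelSpace (arch (↥(maximalRealSubfield L)) L (IsCMField.complexConj L) 3 H₂ ⧸ Subgroup.centralizer ({γ} : Set _))]
  [∀ γ : arch (↥(maximalRealSubfield L)) L (IsCMField.complexConj L) 3 (Matrix.diagonal β),
    MeasurableSpace (arch (↥(maximalRealSubfield L)) L (IsCMField.complexConj L) 3 (Matrix.diagonal β) ⧸ Subgroup.centralizer ({γ} : Set _))]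
  [∀ γ : arch (↥(maximalRealSubfield L)) L (IsCMField.complexConj L) 3 (Matrix.diagonal β),
    BorelSpace (arch (↥(maximalRealSubfield L)) L (IsCMField.complexConj L) 3 (Matrix.diagonal β) ⧸ Subgroup.centralizer ({γ} : Set _))]

include hΦ_A in
open scoped Classical in
/-- **(W4c′) THE ARCHIMEDEAN SINGULAR WITNESS FAMILY, ITS DATUM EXPORTED AS THE PULL-BACK.**  Data as in ★ (W4c) `exists_archSingularFamily_of_coherent_torusDatum`: `H′` hermitian
anisotropic; `H₂` a second form with a congruence `Φ_A : U(H₂)(L ⊗ ℝ) ≃ₜ* U(diag β)(L ⊗ ℝ)`, `g ↦ T_A g T_A⁻¹` (`β` real non-zero); `ν′` two-sided Haar on `U(H₂)(L ⊗ ℝ)`, `ν = (Φ_A)_* ν′`;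
`T` a torus datum on `U(diag β)(L ⊗ ℝ)` Haar, inversion-invariant and conjugation-coherent on the wall saturation `Pall a := ∃ (k : {z0 ∕∕ wall}) ρ q, q·t(z0∘ρ)·q⁻¹ = a`.
THEN there are `ms`, `Ts` on `U(H₂)(L ⊗ ℝ)` with: (Q) `ms.IsQuotientOf` the S1′ guard «`∃ γ₀ ∈ U(H′)(L⁺)` non-regular with `γ₀ ⊗ 1 ↔ x`» `ν′ Ts`; (INV) `ms` invariant at every class;
(C1) `ms.atPoint (δ ⊗ 1) (univ) = 1` at every rational scalar `δ = ζ•1 ∈ U(H₂)(L⁺)` [Prop. 10.1.2 (b)]; (PIN) `((Φ_A)_* ms).atPoint (t(z0∘ρ)) = dν ∕ dT_{t(z0∘ρ)}` at every wall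
torus point; and — NEW — (PULL) at every `x` with `Pall (Φ_A x)`, `Ts x = (Φ_A⁻¹|_{Z(Φ_A x)})_* T (Φ_A x)` (★ (W4b′) (v)).  With the guard lemma above, (PULL) holds at every
guard point off the centre: this is where the universal pin ratio (U) on the diagonal carrier reaches the datum of the family on the inner form ((W4f)).
[cite: Rogawski1990, §1.7 p. 6; §3.8 Prop. 3.8.1 (a) p. 27; §4.3 (4.3.1) p. 43; Prop. 10.1.2 (b) p. 146; §14.2 p. 232; §14.5 Lemma 14.5.2 (b) pp. 238–239] [cite: DeitmarEchterhoff2014, Thm. 1.5.3] -/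
theorem exists_archSingularFamily_of_coherent_torusDatum_pullback (hherm : (H'.map (cmConjRingHom L))ᵀ = H')
    (hanis : ∀ x : Fin 3 → L, hermForm (cmConjRingHom L) H' x x = 0 → x = 0) (hβ : ∀ i, β i ≠ 0) (hhermβ : ∀ i, (IsCMField.complexConj L (β i) : L) = β i)
    (ν' : Measure (arch (↥(maximalRealSubfield L)) L (IsCMField.complexConj L) 3 H₂)) [ν'.IsHaarMeasure] [ν'.IsMulRightInvariant]
    (ν : Measure (arch (↥(maximalRealSubfield L)) L (IsCMField.complexConj L) 3 (Matrix.diagonal β))) [ν.IsHaarMeasure] [ν.IsMulRightInvariant] (hν : ν = Measure.map Φ_A ν')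
    (T : ∀ a : arch (↥(maximalRealSubfield L)) L (IsCMField.complexConj L) 3 (Matrix.diagonal β), Measure (Subgroup.centralizer ({a} : Set (arch (↥(maximalRealSubfield L)) L (IsCMField.complexConj L) 3 (Matrix.diagonal β)))))
    (hTi : ∀ a : arch (↥(maximalRealSubfield L)) L (IsCMField.complexConj L) 3 (Matrix.diagonal β),
      (∃ (k : {z0 : {w : InfinitePlace L // IsComplex w} → Fin 3 → Circle // ∀ w, z0 w 0 = z0 w 2 ∧ z0 w 0 ≠ z0 w 1})
        (ρ : {w : InfinitePlace L // IsComplex w} → Perm (Fin 3)) (q : arch (↥(maximalRealSubfield L)) L (IsCMField.complexConj L) 3 (Matrix.diagonal β)),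
        (MulAut.conj q : arch (↥(maximalRealSubfield L)) L (IsCMField.complexConj L) 3 (Matrix.diagonal β) ≃* arch (↥(maximalRealSubfield L)) L (IsCMField.complexConj L) 3 (Matrix.diagonal β)) (archDiagTorus L 3 β fun w => k.1 w ∘ ⇑(ρ w)) = a) →
      (T a).IsHaarMeasure ∧ (T a).IsInvInvariant)
    (hcoh : ∀ (a₁ a₂ q : arch (↥(maximalRealSubfield L)) L (IsCMField.complexConj L) 3 (Matrix.diagonal β)) (hq : (MulAut.conj q : arch (↥(maximalRealSubfield L)) L (IsCMField.complexConj L) 3 (Matrix.diagonal β) ≃* arch (↥(maximalRealSubfield L)) L (IsCMField.complexConj L) 3 (Matrix.diagonal β)) a₁ = a₂),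
      (∃ (k : {z0 : {w : InfinitePlace L // IsComplex w} → Fin 3 → Circle // ∀ w, z0 w 0 = z0 w 2 ∧ z0 w 0 ≠ z0 w 1})
        (ρ : {w : InfinitePlace L // IsComplex w} → Perm (Fin 3)) (q : arch (↥(maximalRealSubfield L)) L (IsCMField.complexConj L) 3 (Matrix.diagonal β)),
        (MulAut.conj q : arch (↥(maximalRealSubfield L)) L (IsCMField.complexConj L) 3 (Matrix.diagonal β) ≃* arch (↥(maximalRealSubfield L)) L (IsCMField.complexConj L) 3 (Matrix.diagonal β)) (archDiagTorus L 3 β fun w => k.1 w ∘ ⇑(ρ w)) = a₁) →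
      Measure.map (subgroupCongrHomeomorph (MulAut.conj q : arch (↥(maximalRealSubfield L)) L (IsCMField.complexConj L) 3 (Matrix.diagonal β) ≃* arch (↥(maximalRealSubfield L)) L (IsCMField.complexConj L) 3 (Matrix.diagonal β))
        (Subgroup.centralizer ({a₁} : Set (arch (↥(maximalRealSubfield L)) L (IsCMField.complexConj L) 3 (Matrix.diagonal β)))) (Subgroup.centralizer ({a₂} : Set (arch (↥(maximalRealSubfield L)) L (IsCMField.complexConj L) 3 (Matrix.diagonal β))))
        (forall_apply_mem_centralizer_singleton_iff_of_eq (MulAut.conj q : arch (↥(maximalRealSubfield L)) L (IsCMField.complexConj L) 3 (Matrix.diagonal β) ≃* arch (↥(maximalRealSubfield L)) L (IsCMField.complexConj L) 3 (Matrix.diagonal β)) hq)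
        (continuous_mulAutConj q) (continuous_mulAutConj_symm q)) (T a₁) = T a₂) :
    ∃ (ms : OrbitalMeasureFamily (arch (↥(maximalRealSubfield L)) L (IsCMField.complexConj L) 3 H₂)) (Ts : ∀ x : arch (↥(maximalRealSubfield L)) L (IsCMField.complexConj L) 3 H₂, Measure (Subgroup.centralizer ({x} : Set (arch (↥(maximalRealSubfield L)) L (IsCMField.complexConj L) 3 H₂)))),
      ms.IsQuotientOf (fun x : arch (↥(maximalRealSubfield L)) L (IsCMField.complexConj L) 3 H₂ => ∃ γ₀ : (cmDatum L 3 H').Rational, ¬ IsRegularElt (γ₀.val : GL (Fin 3) L) ∧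
          Corresponds (conjMixed (↥(maximalRealSubfield L)) L (IsCMField.complexConj L)) (archFormOf L 3 H') (archFormOf L 3 H₂) (cmRationalToArch L 3 H' γ₀) x) ν' Ts ∧
      (∀ c : ConjClasses (arch (↥(maximalRealSubfield L)) L (IsCMField.complexConj L) 3 H₂), SMulInvariantMeasure (arch (↥(maximalRealSubfield L)) L (IsCMField.complexConj L) 3 H₂) (arch (↥(maximalRealSubfield L)) L (IsCMField.complexConj L) 3 H₂ ⧸ Subgroup.centralizer ({(Quotient.out c : arch (↥(maximalRealSubfield L)) L (IsCMField.complexConj L) 3 H₂)} : Set (arch (↥(maximalRealSubfield L)) L (IsCMField.complexConj L) 3 H₂))) (ms c)) ∧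
      (∀ (δ : (cmDatum L 3 H₂).Rational) (ζ : L), (((δ : unitaryGroup (cmConjRingHom L) H₂).val : GL (Fin 3) L) : Matrix (Fin 3) (Fin 3) L) = ζ • (1 : Matrix (Fin 3) (Fin 3) L) →
        ms.atPoint (cmRationalToArch L 3 H₂ δ) Set.univ = 1) ∧
      (∀ (z0 : {w : InfinitePlace L // IsComplex w} → Fin 3 → Circle) (_ : ∀ w, z0 w 0 = z0 w 2 ∧ z0 w 0 ≠ z0 w 1) (ρ : {w : InfinitePlace L // IsComplex w} → Perm (Fin 3)),
        ∃ (_ : (T (archDiagTorus L 3 β fun w => z0 w ∘ ⇑(ρ w))).IsHaarMeasure) (_ : (T (archDiagTorus L 3 β fun w => z0 w ∘ ⇑(ρ w))).IsInvInvariant),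
          (ms.transport Φ_A.toMulEquiv Φ_A.continuous Φ_A.symm.continuous).atPoint (archDiagTorus L 3 β fun w => z0 w ∘ ⇑(ρ w)) =
            quotientMeasure (Subgroup.centralizer ({archDiagTorus L 3 β fun w => z0 w ∘ ⇑(ρ w)} : Set (arch (↥(maximalRealSubfield L)) L (IsCMField.complexConj L) 3 (Matrix.diagonal β))))
              (T (archDiagTorus L 3 β fun w => z0 w ∘ ⇑(ρ w))) (isClosed_coe_centralizer_singleton _) ν) ∧
      -- (PULL): on the wall saturation through `Φ_A`, the datum IS the pull-back of `T`
      (∀ x : arch (↥(maximalRealSubfield L)) L (IsCMField.complexConj L) 3 H₂,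
        (∃ (k : {z0 : {w : InfinitePlace L // IsComplex w} → Fin 3 → Circle // ∀ w, z0 w 0 = z0 w 2 ∧ z0 w 0 ≠ z0 w 1})
          (ρ : {w : InfinitePlace L // IsComplex w} → Perm (Fin 3)) (q : arch (↥(maximalRealSubfield L)) L (IsCMField.complexConj L) 3 (Matrix.diagonal β)),
          (MulAut.conj q : arch (↥(maximalRealSubfield L)) L (IsCMField.complexConj L) 3 (Matrix.diagonal β) ≃* arch (↥(maximalRealSubfield L)) L (IsCMField.complexConj L) 3 (Matrix.diagonal β)) (archDiagTorus L 3 β fun w => k.1 w ∘ ⇑(ρ w)) = Φ_A x) →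
        Ts x = (T (Φ_A x)).map (subgroupCongrHomeomorph Φ_A.toMulEquiv.symm
          (Subgroup.centralizer ({Φ_A x} : Set (arch (↥(maximalRealSubfield L)) L (IsCMField.complexConj L) 3 (Matrix.diagonal β))))
          (Subgroup.centralizer ({x} : Set (arch (↥(maximalRealSubfield L)) L (IsCMField.complexConj L) 3 H₂)))
          (forall_apply_mem_centralizer_singleton_iff_of_eq Φ_A.toMulEquiv.symm (Φ_A.toMulEquiv.symm_apply_apply x)) Φ_A.symm.continuous Φ_A.continuous)) := by
  haveI : ∀ γ : arch (↥(maximalRealSubfield L)) L (IsCMField.complexConj L) 3 H₂, LocallyCompactSpace (arch (↥(maximalRealSubfield L)) L (IsCMField.complexConj L) 3 H₂) := fun _ => inferInstance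
  -- the generic construction ★ (W4b′), `P := Pall`, `Cen x := x is a scalar ζ ⊗ 1`
  obtain ⟨ms, Ts, hQ, hinv, hcen, hwall, hpull⟩ := exists_isQuotientOf_of_coherent_torusDatum_pullback Φ_A.toMulEquiv Φ_A.continuous Φ_A.symm.continuous ν' ν hν
    (P := fun a : arch (↥(maximalRealSubfield L)) L (IsCMField.complexConj L) 3 (Matrix.diagonal β) =>
      ∃ (k : {z0 : {w : InfinitePlace L // IsComplex w} → Fin 3 → Circle // ∀ w, z0 w 0 = z0 w 2 ∧ z0 w 0 ≠ z0 w 1})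
        (ρ : {w : InfinitePlace L // IsComplex w} → Perm (Fin 3)) (q : arch (↥(maximalRealSubfield L)) L (IsCMField.complexConj L) 3 (Matrix.diagonal β)),
        (MulAut.conj q : arch (↥(maximalRealSubfield L)) L (IsCMField.complexConj L) 3 (Matrix.diagonal β) ≃* arch (↥(maximalRealSubfield L)) L (IsCMField.complexConj L) 3 (Matrix.diagonal β)) (archDiagTorus L 3 β fun w => k.1 w ∘ ⇑(ρ w)) = a)
    (fun a q' ⟨k, ρ, q, hq⟩ => ⟨k, ρ, q' * q, by rw [map_mul, MulAut.mul_apply, hq, MulAut.conj_apply]⟩)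
    (Cen := fun x : arch (↥(maximalRealSubfield L)) L (IsCMField.complexConj L) 3 H₂ => ∃ ζ : L, ((x : GL (Fin 3) (mixedSpace L)) : Matrix (Fin 3) (Fin 3) (mixedSpace L)) = mixedEmbedding L ζ • (1 : Matrix (Fin 3) (Fin 3) (mixedSpace L)))
    (fun x ⟨ζ, hx⟩ g => Subtype.ext (commute_of_coe_eq_smul_one hx (g : GL (Fin 3) (mixedSpace L))))
    (fun x ⟨ζ, hx⟩ ⟨k, ρ, q, hq⟩ => by
      obtain ⟨w₀⟩ : Nonempty {w : InfinitePlace L // IsComplex w} := ⟨⟨Classical.arbitrary (InfinitePlace L), IsTotallyComplex.isComplex _⟩⟩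
      exact conj_archDiagTorus_ne_archCongr_of_coe_eq_smul_one L β T_A Φ_A hΦ_A hx k.1 w₀ (k.2 w₀).2 ρ q hq)
    T hTi hcoh
  refine ⟨ms, Ts, hQ.mono fun x hx => ?_, hinv, fun δ ζ hδ => hcen _ ⟨ζ, coe_coe_cmRationalToArch_eq_smul_one_of_smul_one hδ⟩, fun z0 hz0 ρ => hwall _ ⟨⟨z0, hz0⟩, ρ, 1, by simp⟩,
    fun x hx => hpull x hx⟩
  -- the guard lands in `Pall ∘ Φ_A ∨ Cen` (the guard lemma, or the centre)
  by_cases hc : ∃ ζ : L, ((x : GL (Fin 3) (mixedSpace L)) : Matrix (Fin 3) (Fin 3) (mixedSpace L)) = mixedEmbedding L ζ • (1 : Matrix (Fin 3) (Fin 3) (mixedSpace L))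
  · exact Or.inr hc
  · obtain ⟨zw, hw, -, ρ, q, hq⟩ := exists_conj_archDiagTorus_eq_archCongr_of_not_central L H' β T_A Φ_A hΦ_A hherm hanis hβ hhermβ hx hc
    exact Or.inl ⟨⟨zw, hw⟩, ρ, q, hq⟩

end ArchWitnessPullback

end Literature.NumberTheory.Rogawski1990

end
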